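import Literature.NumberTheory.Rogawski1990.ArchTransfFamilyJumpJets     -- PART 3a (LH7-p02 (g2)): letters, the six classes on the jets; brings PART 2b∕2a, ★ B1 WallGeometry, ★ BoundedJetsLeibnizReflection
import HarnessLib

/-!
# (I₃) for the candidate transfer family — PART 3b (JETS, SUMMED): the κ-weighted partner `ρ = ρ′σ` re-lettered by `ρ′`, and the resolved partner sum's jet jump
# `(2 + 2(−1)^{a(u)}) · jc′ S w₀ 0 2 · Σ″` (Shelstad 1979 Thm. 4.7 (IIIb) p. 31; Bouaziz 1994 §3.2 (I₃), Rem. 2 p. 594)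

Topic `NumberTheory/Rogawski1990`; namespace `Literature.NumberTheory.Rogawski1990`.  THEOREMS ONLY (no `def`, no instance, no notation, no axiom, no named fact, no `sorry`).
Cell `pub/hodgecm-mathlib`, line LH3 (closer stub `stub_N9`, crux H413 = `stmt-HodgeConjecture-24833`), organ **O-L2 (I₃-TRANSF)**, ED. 3 brick (W1, second half) of the (P)
«pointwise all orders» half (LH3-plan (g3) 2026-09-02T07:53Z; author LH7-p02 (g2)).  For `ρ ∈ partnerPerms S` write `ρ = ρ′σ` (`ρ′ = update ρ w₀ 1`, `σ = ρ w₀`): the curve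
and the word are re-lettered by `ρ′` (`slotPerm ρ′ (bzAdaptedVec w₀ l) = bzAdaptedVec w₀ (l.1, ρ′_{l.1}⁻¹ l.2)`, PART 3a), PART 3a's six classes apply at `ρ′·p`, and
`κ_{ρ′σ} = sign σ·κ_{ρ′}` (PART 2b) turns the class jump `sign σ·o_σ(u)·J` into `o_σ(u)·κ_{ρ′}·J_{ρ′}(u)`; summing, `Σ_σ [σ⁻¹1 ≠ 2]·o_σ(u) = 2 + 2(−1)^{a(u)}`
(`sum_perm_ite_orient`), so the resolved partner sum's `u`-jet jumps by `(2 + 2(−1)^{a(u)})·jc′₀₂·Σ_{ρ′} κ_{ρ′}·I^{a(u)}·Dʲ('F_{S″}∘slotPerm ρ′)(cayPt w₀ p)(Cayley u)`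
(`hasOneSidedJump_resolvedSum_jet`).  HONEST LABEL: HC_CM is proved only modulo the 7 printed citations (2 remaining: hLiu418 = `stmt-HodgeConjecture-24832`, h413 =
`stmt-HodgeConjecture-24833`) until rung 0 closes; count-neutral.

## References
* [Shelstad1979] D. Shelstad, *Characters and inner forms of a quasi-split group over ℝ*, Compositio Math. 39 (1979), §4: Lemma 4.2 p. 23, Lemma 4.3 p. 25, Thm. 4.7 (IIIb) p. 31.
* [Bouaziz1994IntegralesOrbitales] A. Bouaziz, *Intégrales orbitales sur les groupes de Lie réductifs*, Ann. Sci. ÉNS 27 (1994), §3.2 (I₃) p. 580, Rem. 2 p. 594.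
* [Rogawski1990] J. D. Rogawski, *Automorphic Representations of Unitary Groups in Three Variables* (1990), §4.3 (4.3.1) p. 43.
-/

set_option autoImplicit false

noncomputable section

open NumberField NumberField.InfinitePlace Complex Set Filter Topology Equiv Finset
open scoped Classical Real ContDiff
open Literature.NumberTheory.Automorphic Literature.NumberTheory.Automorphic.UnitaryGroup Literature.NumberTheory.Automorphic.ArchCartan
open Literature.NumberTheory.Automorphic.Shelstad1979.StableOrbitalIntegrals
open Literature.NumberTheory.GaloisRepresentations
open Literature.Analysis.Calculus

namespace Literature.NumberTheory.Rogawski1990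
/-! ## §3 The partner `ρ = ρ′σ`: κ-weights, re-lettering by `ρ′`, and the sum over the partners -/

section Partner

variable (L : Type) [Field L] [NumberField L] [IsCMField L] (α : Fin 3 → L)

/-- The orientation count is unchanged by re-lettering at the other places (`ρ′ w₀ = 1`). [cite: Shelstad1979, Lemma 4.3 (p. 25)] -/
theorem card_filter_reletter_eq {W : Type*} [DecidableEq W] {ρ' : W → Perm (Fin 3)} {w₀ : W} (h : ρ' w₀ = 1) {n : ℕ} (u : Fin n → W × Fin 3) :
    (Finset.univ.filter fun r => ((u r).1, (ρ' (u r).1).symm (u r).2) = (w₀, (0 : Fin 3))).card = (Finset.univ.filter fun r => u r = (w₀, 0)).card := by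
  congr 1
  ext r
  simp only [Finset.mem_filter, Finset.mem_univ, true_and, Prod.mk.injEq]
  constructor
  · rintro ⟨h1, h2⟩
    refine Prod.ext h1 ?_
    rw [h1, h, ← Equiv.Perm.inv_def, inv_one, Equiv.Perm.coe_one, id_eq] at h2
    exact h2
  · intro hr
    rw [hr, h, ← Equiv.Perm.inv_def, inv_one, Equiv.Perm.coe_one, id_eq]
    exact ⟨rfl, rfl⟩

/-- **The orientation-weighted count of the jumping classes**: `Σ_{σ ∈ S₃} [σ⁻¹1 ≠ 2]·(1 if σ⁻¹0 < σ⁻¹2 else x) = 2 + 2x` (the classes `1, (01)` are oriented, `(02), (012)` reversed).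
[cite: Shelstad1979, Thm. 4.7 (IIIb) p. 31] -/
theorem sum_perm_ite_orient (x : ℂ) :
    ∑ σ : Perm (Fin 3), (if σ.symm 1 ≠ 2 then (if σ.symm 0 < σ.symm 2 then (1 : ℂ) else x) else 0) = 2 + 2 * x := by
  have hsplit : ∀ σ : Perm (Fin 3), (if σ.symm 1 ≠ 2 then (if σ.symm 0 < σ.symm 2 then (1 : ℂ) else x) else 0) =
      (if (σ.symm 1 ≠ 2 ∧ σ.symm 0 < σ.symm 2) then (1 : ℂ) else 0) + (if (σ.symm 1 ≠ 2 ∧ ¬ σ.symm 0 < σ.symm 2) then (1 : ℂ) else 0) * x := by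
    intro σ
    by_cases hA : σ.symm 1 ≠ 2 <;> by_cases hB : σ.symm 0 < σ.symm 2 <;> simp [hA, hB]
  simp only [hsplit, Finset.sum_add_distrib, ← Finset.sum_mul, Finset.sum_boole]
  have h1 : ((Finset.univ : Finset (Perm (Fin 3))).filter fun σ => σ.symm 1 ≠ 2 ∧ σ.symm 0 < σ.symm 2).card = 2 := by decide
  have h2 : ((Finset.univ : Finset (Perm (Fin 3))).filter fun σ => σ.symm 1 ≠ 2 ∧ ¬ σ.symm 0 < σ.symm 2).card = 2 := by decide
  rw [h1, h2]
  norm_num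

/-- **The partner sum re-indexed with orientation weights**: `Σ_{ρ ∈ partnerPerms S} [(ρ w₀)⁻¹1 ≠ 2]·o_{ρ w₀}·Φ(update ρ w₀ 1) = (2 + 2x)·Σ_{ρ′ ∈ partnerPerms (insert w₀ S)} Φ ρ′`.
[cite: Shelstad1979, Lemma 4.2 (p. 23); Thm. 4.7 (IIIb) p. 31] -/
theorem sum_partnerPerms_ite_orient {W : Type*} [Fintype W] [DecidableEq W] {S : Finset W} {w₀ : W} (hw₀ : w₀ ∉ S) (x : ℂ) (Φ : (W → Perm (Fin 3)) → ℂ) :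
    ∑ ρ ∈ partnerPerms S, (if (ρ w₀).symm 1 ≠ 2 then (if (ρ w₀).symm 0 < (ρ w₀).symm 2 then (1 : ℂ) else x) * Φ (Function.update ρ w₀ 1) else 0) =
      (2 + 2 * x) * ∑ ρ' ∈ partnerPerms (insert w₀ S), Φ ρ' := by
  rw [sum_partnerPerms_eq_sum_insert_sum_perm hw₀, Finset.mul_sum]
  refine Finset.sum_congr rfl fun ρ' hρ' => ?_
  have h1 : ρ' w₀ = 1 := eq_one_of_mem_partnerPerms hρ' (Finset.mem_insert_self w₀ S)
  have hrw : ∀ σ : Perm (Fin 3), (if (Function.update ρ' w₀ σ w₀).symm 1 ≠ 2 then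
      (if (Function.update ρ' w₀ σ w₀).symm 0 < (Function.update ρ' w₀ σ w₀).symm 2 then (1 : ℂ) else x) * Φ (Function.update (Function.update ρ' w₀ σ) w₀ 1) else 0) =
      (if σ.symm 1 ≠ 2 then (if σ.symm 0 < σ.symm 2 then (1 : ℂ) else x) else 0) * Φ ρ' := by
    intro σ
    rw [Function.update_self, Function.update_idem, ← h1, Function.update_eq_self]
    split_ifs <;> simp
  simp only [hrw]
  rw [← Finset.sum_mul, sum_perm_ite_orient]

omit [IsCMField L] in
/-- **ONE PARTNER, ALL ORDERS**: for `ρ ∈ partnerPerms S` (`ρ′ = update ρ w₀ 1`, `σ = ρ w₀`) and a word `u`, the κ-weighted twisted jet `t ↦ κ_ρ·Dʲ('F_S∘slotPerm ρ)(p + t•nrm w₀)(u)`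
jumps by `o_σ(u) · jc′ S w₀ 0 2 · κ_{ρ′} · I^{a(u)} · Dʲ('F_{S″}∘slotPerm ρ′)(cayPt w₀ p)(Cayley u)` if `σ⁻¹1 ≠ 2`, and by `0` otherwise (§2 at the re-lettered data `ρ′·p`, `ρ′·u`;
PART 2b `κ_{ρ′σ} = sign σ·κ_{ρ′}`). [cite: Shelstad1979, Lemma 4.3 p. 25; Thm. 4.7 (IIIb) p. 31] [cite: Bouaziz1994IntegralesOrbitales, §3.2 (I₃) p. 580] -/
theorem hasOneSidedJump_kappa_jet_partner (hα : ∀ i, α i ≠ 0) {S : Finset {w : InfinitePlace L // IsComplex w}}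
    {w₀ : {w : InfinitePlace L // IsComplex w}} (hw₀ : w₀ ∉ S) (hcov : w₀ ∈ splitChartPlaces L α)
    {jc' : Finset {w : InfinitePlace L // IsComplex w} → {w : InfinitePlace L // IsComplex w} → Fin 3 → Fin 3 → ℂ}
    {F : Finset {w : InfinitePlace L // IsComplex w} → ({w : InfinitePlace L // IsComplex w} → Fin 3 → ℝ) → ℂ} (hF : ArchHCSpaceG (slotSign L α) jc' F)
    {p : {w : InfinitePlace L // IsComplex w} → Fin 3 → ℝ} (hs02 : p w₀ 0 = p w₀ 2) (hs1 : Circle.exp (p w₀ 1) ≠ Circle.exp (p w₀ 0))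
    (hreg : ∀ v, v ∉ S → v ≠ w₀ → Function.Injective fun i : Fin 3 => Circle.exp (p v i)) (hx : ∀ v ∈ S, p v 0 ≠ 0)
    {ρ : {w : InfinitePlace L // IsComplex w} → Perm (Fin 3)} (hρ : ρ ∈ partnerPerms S) (j : ℕ) (u : Fin j → {w : InfinitePlace L // IsComplex w} × Fin 3) :
    HasOneSidedJump
      (fun t : ℝ => (((∏ w : {w : InfinitePlace L // IsComplex w},
            ((SignType.sign ((w.1.embedding (α (lineOf (formSign L α w) ((ρ w).symm 1)))).re) : ℤ) * archMajoritySign L (Matrix.diagonal α) w) : ℤ) : ℂ) *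
          ∏ w : {w : InfinitePlace L // IsComplex w}, (Equiv.Perm.sign (ρ w) : ℂ)) *
        iteratedFDeriv ℝ j (fun c => archERhoG S (slotPerm ρ c) * F S (slotPerm ρ c)) (p + t • nrm w₀) (fun i => bzAdaptedVec w₀ (u i)))
      (if (ρ w₀).symm 1 ≠ 2 then
        (if (ρ w₀).symm 0 < (ρ w₀).symm 2 then (1 : ℂ) else (((-1 : ℝ) ^ (Finset.univ.filter fun r => u r = (w₀, 0)).card : ℝ) : ℂ)) *
          (jc' S w₀ 0 2 * ((((∏ w : {w : InfinitePlace L // IsComplex w},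
            ((SignType.sign ((w.1.embedding (α (lineOf (formSign L α w) ((Function.update ρ w₀ 1 w).symm 1)))).re) : ℤ) * archMajoritySign L (Matrix.diagonal α) w) : ℤ) : ℂ) *
          ∏ w : {w : InfinitePlace L // IsComplex w}, (Equiv.Perm.sign (Function.update ρ w₀ 1 w) : ℂ)) *
            (bzCayScalar w₀ u * iteratedFDeriv ℝ j (fun c => archERhoG (insert w₀ S) (slotPerm (Function.update ρ w₀ 1) c) * F (insert w₀ S) (slotPerm (Function.update ρ w₀ 1) c))
              (cayPt w₀ p) (fun i => bzCayVec (u i)))))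
       else 0) := by
  obtain ⟨h10, -, -⟩ := slotSign_of_mem_splitChartPlaces L α hα hcov
  have hρ' : Function.update ρ w₀ 1 ∈ partnerPerms (insert w₀ S) := update_one_mem_partnerPerms_insert w₀ hρ
  have h1 : Function.update ρ w₀ 1 w₀ = 1 := by rw [Function.update_self]
  obtain ⟨hs02', hs1', hreg', hx'⟩ := semireg_slotPerm hρ' hs02 hs1 hreg hx
  -- the six classes at the re-lettered data
  have hsix := hasOneSidedJump_jet_slotPerm_update_one L α hα hw₀ hcov hF hs02' hs1' hreg' hx' (ρ w₀) j
    (fun r => ((u r).1, ((Function.update ρ w₀ 1) (u r).1).symm (u r).2))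
  -- the curve identity `Dʲ('F_S∘ρ)(p + t•n)(u) = Dʲ('F_S∘σ)(ρ′p + t•n)(ρ′·u)`
  have hfun : (fun c => archERhoG S (slotPerm ρ c) * F S (slotPerm ρ c)) = fun c =>
      (fun c' => archERhoG S (slotPerm (Function.update (1 : {w : InfinitePlace L // IsComplex w} → Perm (Fin 3)) w₀ (ρ w₀)) c') *
        F S (slotPerm (Function.update (1 : {w : InfinitePlace L // IsComplex w} → Perm (Fin 3)) w₀ (ρ w₀)) c')) (slotPerm (Function.update ρ w₀ 1) c) := by
    funext c
    rw [slotPerm_eq_slotPerm_update_one ρ w₀ c]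
  have hcurve : ∀ t : ℝ, iteratedFDeriv ℝ j (fun c => archERhoG S (slotPerm ρ c) * F S (slotPerm ρ c)) (p + t • nrm w₀) (fun i => bzAdaptedVec w₀ (u i)) =
      iteratedFDeriv ℝ j (fun c => archERhoG S (slotPerm (Function.update (1 : {w : InfinitePlace L // IsComplex w} → Perm (Fin 3)) w₀ (ρ w₀)) c) *
        F S (slotPerm (Function.update (1 : {w : InfinitePlace L // IsComplex w} → Perm (Fin 3)) w₀ (ρ w₀)) c))
        (slotPerm (Function.update ρ w₀ 1) p + t • nrm w₀) (fun i => bzAdaptedVec w₀ ((u i).1, ((Function.update ρ w₀ 1) (u i).1).symm (u i).2)) := by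
    intro t
    have h := iteratedFDeriv_comp_slotPerm_apply L
      (fun c' => archERhoG S (slotPerm (Function.update (1 : {w : InfinitePlace L // IsComplex w} → Perm (Fin 3)) w₀ (ρ w₀)) c') *
        F S (slotPerm (Function.update (1 : {w : InfinitePlace L // IsComplex w} → Perm (Fin 3)) w₀ (ρ w₀)) c'))
      (Function.update ρ w₀ 1) (p + t • nrm w₀) j (fun i => bzAdaptedVec w₀ (u i))
    rw [hfun]
    simpa only [slotPerm_add_smul_nrm_of_apply_eq_one h1, slotPerm_bzAdaptedVec h1] using h
  simp only [hcurve]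
  refine HasOneSidedJump.jump_congr (HasOneSidedJump.const_mul _ hsix) ?_
  -- the Cayley data re-lettered back: `Dʲ'F″(ρ′q)(ρ′·Cayley u) = Dʲ('F″∘ρ′)(q)(Cayley u)`
  have hcay : iteratedFDeriv ℝ j (fun c => archERhoG (insert w₀ S) c * F (insert w₀ S) c) (cayPt w₀ (slotPerm (Function.update ρ w₀ 1) p))
        (fun i => bzCayVec (((u i).1, ((Function.update ρ w₀ 1) (u i).1).symm (u i).2))) =
      iteratedFDeriv ℝ j (fun c => archERhoG (insert w₀ S) (slotPerm (Function.update ρ w₀ 1) c) * F (insert w₀ S) (slotPerm (Function.update ρ w₀ 1) c))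
        (cayPt w₀ p) (fun i => bzCayVec (u i)) := by
    have h := iteratedFDeriv_comp_slotPerm_apply L (fun c => archERhoG (insert w₀ S) c * F (insert w₀ S) c) (Function.update ρ w₀ 1) (cayPt w₀ p) j
      (fun i => bzCayVec (u i))
    rw [cayPt_slotPerm_of_apply_eq_one h1]
    simpa only [slotPerm_bzCayVec] using h.symm
  have hsq : (Equiv.Perm.sign (ρ w₀) : ℂ) * (Equiv.Perm.sign (ρ w₀) : ℂ) = 1 := by
    rcases Int.units_eq_one_or (Equiv.Perm.sign (ρ w₀)) with h | h <;> simp [h]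
  have key : ∀ (s K o Y Z V : ℂ), s * s = 1 → s * K * (s * o * (Y * (Z * V))) = o * (Y * (K * (Z * V))) := by
    intro s K o Y Z V h
    linear_combination (o * (Y * (K * (Z * V)))) * h
  split_ifs with hA hB
  · rw [kappa_eq_sign_mul_kappa_update L α h10 ρ hA, bzCayScalar_reletter h1, hcay]
    exact key _ _ _ _ _ _ hsq
  · rw [kappa_eq_sign_mul_kappa_update L α h10 ρ hA, card_filter_reletter_eq h1, bzCayScalar_reletter h1, hcay]
    exact key _ _ _ _ _ _ hsq
  · rw [mul_zero]

omit [IsCMField L] in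
/-- **THE RESOLVED PARTNER SUM, ALL ORDERS**: for a word `u` the κ-weighted sum of the twisted partner jets `t ↦ Σ_ρ κ_ρ·Dʲ('F_S∘slotPerm ρ)(p + t•nrm w₀)(u)` jumps by
`(2 + 2(−1)^{a(u)}) · jc′ S w₀ 0 2 · Σ_{ρ′ ∈ partnerPerms (insert w₀ S)} κ_{ρ′} · I^{a(u)} · Dʲ('F_{S″}∘slotPerm ρ′)(cayPt w₀ p)(Cayley u)` — EVEN normal jets jump by `4·(…)`, ODD ones
do not jump. [cite: Shelstad1979, Thm. 4.7 (IIIb) p. 31] [cite: Bouaziz1994IntegralesOrbitales, §3.2 (I₃) p. 580; Rem. 2 p. 594] -/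
theorem hasOneSidedJump_resolvedSum_jet (hα : ∀ i, α i ≠ 0) {S : Finset {w : InfinitePlace L // IsComplex w}}
    {w₀ : {w : InfinitePlace L // IsComplex w}} (hw₀ : w₀ ∉ S) (hcov : w₀ ∈ splitChartPlaces L α)
    {jc' : Finset {w : InfinitePlace L // IsComplex w} → {w : InfinitePlace L // IsComplex w} → Fin 3 → Fin 3 → ℂ}
    {F : Finset {w : InfinitePlace L // IsComplex w} → ({w : InfinitePlace L // IsComplex w} → Fin 3 → ℝ) → ℂ} (hF : ArchHCSpaceG (slotSign L α) jc' F)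
    {p : {w : InfinitePlace L // IsComplex w} → Fin 3 → ℝ} (hs02 : p w₀ 0 = p w₀ 2) (hs1 : Circle.exp (p w₀ 1) ≠ Circle.exp (p w₀ 0))
    (hreg : ∀ v, v ∉ S → v ≠ w₀ → Function.Injective fun i : Fin 3 => Circle.exp (p v i)) (hx : ∀ v ∈ S, p v 0 ≠ 0)
    (j : ℕ) (u : Fin j → {w : InfinitePlace L // IsComplex w} × Fin 3) :
    HasOneSidedJump
      (fun t : ℝ => ∑ ρ ∈ partnerPerms S, (((∏ w : {w : InfinitePlace L // IsComplex w},
            ((SignType.sign ((w.1.embedding (α (lineOf (formSign L α w) ((ρ w).symm 1)))).re) : ℤ) * archMajoritySign L (Matrix.diagonal α) w) : ℤ) : ℂ) *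
          ∏ w : {w : InfinitePlace L // IsComplex w}, (Equiv.Perm.sign (ρ w) : ℂ)) *
        iteratedFDeriv ℝ j (fun c => archERhoG S (slotPerm ρ c) * F S (slotPerm ρ c)) (p + t • nrm w₀) (fun i => bzAdaptedVec w₀ (u i)))
      ((2 + 2 * (((-1 : ℝ) ^ (Finset.univ.filter fun r => u r = (w₀, 0)).card : ℝ) : ℂ)) *
        ∑ ρ' ∈ partnerPerms (insert w₀ S), jc' S w₀ 0 2 * ((((∏ w : {w : InfinitePlace L // IsComplex w},
            ((SignType.sign ((w.1.embedding (α (lineOf (formSign L α w) ((ρ' w).symm 1)))).re) : ℤ) * archMajoritySign L (Matrix.diagonal α) w) : ℤ) : ℂ) *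
          ∏ w : {w : InfinitePlace L // IsComplex w}, (Equiv.Perm.sign (ρ' w) : ℂ)) *
          (bzCayScalar w₀ u * iteratedFDeriv ℝ j (fun c => archERhoG (insert w₀ S) (slotPerm ρ' c) * F (insert w₀ S) (slotPerm ρ' c))
            (cayPt w₀ p) (fun i => bzCayVec (u i))))) := by
  refine HasOneSidedJump.jump_congr (hasOneSidedJump_sum (partnerPerms S) fun ρ hρ =>
    hasOneSidedJump_kappa_jet_partner L α hα hw₀ hcov hF hs02 hs1 hreg hx hρ j u) ?_
  exact sum_partnerPerms_ite_orient hw₀ _ (fun ρ' => jc' S w₀ 0 2 * ((((∏ w : {w : InfinitePlace L // IsComplex w},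
            ((SignType.sign ((w.1.embedding (α (lineOf (formSign L α w) ((ρ' w).symm 1)))).re) : ℤ) * archMajoritySign L (Matrix.diagonal α) w) : ℤ) : ℂ) *
          ∏ w : {w : InfinitePlace L // IsComplex w}, (Equiv.Perm.sign (ρ' w) : ℂ)) *
    (bzCayScalar w₀ u * iteratedFDeriv ℝ j (fun c => archERhoG (insert w₀ S) (slotPerm ρ' c) * F (insert w₀ S) (slotPerm ρ' c))
      (cayPt w₀ p) (fun i => bzCayVec (u i)))))

end Partner

end Literature.NumberTheory.Rogawski1990

end
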